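import Literature.Probability.RandomPlanarGeometry.HexSAWStripSurfaceWidthOne
import Literature.Probability.RandomPlanarGeometry.HexSAWStripWidthOneArcs
import HarnessLib

/-!
# The width-one strip with surface weights in closed form: `A_{1,L}(x_c; y)`, `E_{1,L}(x_c; y)`, and the exact profile at `y_1`

Topic `Literature/Probability/RandomPlanarGeometry` (continues `HexSAWStripSurfaceWidthOne.lean` — `HV.stripGFy_beta_one_eq :
B_{1,L}(x_c; y) = 2 Σ_{k=1}^{L+1} (x_c² y)^k`, `HV.stripYT_one : y_1 = 2 + √2` — and `HexSAWStripWidthOneArcs.lean` — the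
classifications of the `α`- and `ε`-walks of `S_{1,L}` as `HV.zagWalk s j` / `HV.epsWalk s L` (`filter_isAlphaDart_one_eq_image`,
`filter_isEpsDart_one_eq_image`) and the unweighted closed forms `stripA_one_eq`, `stripE_one_eq`).  Source: N. R. Beaton,
M. Bousquet-Mélou, J. de Gier, H. Duminil-Copin, A. J. Guttmann, *The critical fugacity for surface adsorption of self-avoiding walks
on the honeycomb lattice is `1 + √2`*, Comm. Math. Phys. 326 (2014) 727–754, arXiv:1109.0358v5, §2 eq. (10) (p. 6: `A_{T,L}(x;y)`,
`E_{T,L}(x;y)`), §3.2 Corollary 8 (p. 12) and §4.1 eq. (16) (p. 13); secondary N. R. Beaton, A. J. Guttmann, I. Jensen, J. Phys. A 45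
(2012) 055208 = arXiv:1110.6695, §2 (p. 4, after eq. (4): "A_0(x, y) = 2x³y/(1 − x²y)", denominator printed "1 − x²" sic — their width
`0` = the lane's `T = 1`).  Edition 2 (docstring-only: lit-1 g16's AS-PRINTED token 23:23:05Z folded).

## What is proved (namespace `Literature.Probability.RandomPlanarGeometry.SAW.HV`; standard axioms)

* `surfContacts_one_zagWalk` (`= j`), `surfContacts_one_epsWalk` (`= L + 1`) — contact counts of the classified walks;
* **`stripGFy_alpha_one_eq`** — `A_{1,L}(x_c; y) = 2 x_c Σ_{j=1}^{L} (x_c² y)^j` (BGJ12-Ads' `A_0(x,y)` truncated at `L`);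
  **`stripGFy_eps_one_eq`** — `E_{1,L}(x_c; y) = 2 x_c^{2L+2} y^{L+1} = 2 (x_c² y)^{L+1}`;
* ★ the PROFILE AT THE THRESHOLD `y_1 = 2 + √2 = x_c⁻²` (every `(x_c² y_1)^k = 1`): **`stripGFy_eps_one_stripYT_one : E_{1,L}(x_c; y_1) = 2`**
  for every `L` (the side exits do NOT vanish at the threshold — constant), **`stripGFy_alpha_one_stripYT_one :
  A_{1,L}(x_c; y_1) = 2 x_c · L`** (the arches diverge exactly linearly, like the bridges `B_{1,L}(x_c; y_1) = 2(L+1)` of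
  `HexSAWStripSurfaceWidthOneThreshold.lean`); and the identity (16) at `(T, y) = (1, y_1)` read in closed form:
  `cos(3π/8)·2x_c L + cos(π/4)·2 + β(y_1)·2(L+1) = 1` (`identityY_one_stripYT_one`, via `HV.stripIdentityY_holds`); `tendsto_stripGFy_alpha_one_stripYT_one_atTop`.

Label: lane corollary XS (exact width-one instances; print has `A_0(x,y)` as a rational function and no statement at `y_1`).
Lane «pcv-sawmu», a-p2 g11, 2026-08-23.
-/

noncomputable section

open Finset Filter Topology

namespace Literature.Probability.RandomPlanarGeometry.SAW.HV

/-- Among the positions `0, s, 2s, …, (n−1)s` (`s = ±1`) exactly `n / 2` are odd. [cite: BeatonBousquetMelouDeGierDuminilCopinGuttmann2014, proof of Proposition 5 (arXiv v5 p. 9: zig-zag walks); lane: counting] -/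
private theorem length_filter_odd_range' (s : ℤ) (hs : s = 1 ∨ s = -1) (n : ℕ) :
    ((List.range n).filter fun i : ℕ => s * (i : ℤ) % 2 = 1).length = n / 2 := by
  induction n with
  | zero => simp
  | succ n ih =>
    rw [List.range_succ, List.filter_append, List.length_append, ih, List.filter_singleton]
    by_cases hn : n % 2 = 1
    · have h1 : decide (s * ((n : ℕ) : ℤ) % 2 = 1) = true := by
        rw [decide_eq_true_iff]; rcases hs with rfl | rfl <;> omega
      rw [h1]; simp; omega
    · have h0 : decide (s * ((n : ℕ) : ℤ) % 2 = 1) = false := by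
        rw [decide_eq_false_iff_not]; rcases hs with rfl | rfl <;> omega
      rw [h0]; simp; omega

/-- The surface contacts of `w :: (zigInner s n ++ [u])` in the width-one strip: `n / 2` (the odd positions).
[cite: BeatonBousquetMelouDeGierDuminilCopinGuttmann2014, §2 (arXiv v5 p. 4: c(γ)) with the proof of Proposition 5 (p. 9)] -/
private theorem surfContacts_one_zigInner {s : ℤ} (hs : s = 1 ∨ s = -1) (n : ℕ) (u : HV) :
    surfContacts 1 (wOut :: (zigInner s n ++ [u])) = n / 2 := by
  rw [surfContacts_cons_append, zigInner, List.filter_map, List.length_map]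
  have : ((List.range n).filter ((fun v => decide (lev v = 2 * ((1 : ℕ) : ℤ) - 1)) ∘ fun i : ℕ => vtx (s * (i : ℤ)))) =
      (List.range n).filter fun i : ℕ => s * (i : ℤ) % 2 = 1 := by
    refine List.filter_congr fun i _ => ?_
    simp only [Function.comp, lev, vtx_snd, bit_vtx, mul_zero, zero_add, Nat.cast_one, decide_eq_decide]
    norm_num
  rw [this, length_filter_odd_range' s hs n]

/-- **The `α`-walk `zagWalk s j` has `j` surface contacts.** [cite: BeatonBousquetMelouDeGierDuminilCopinGuttmann2014, §2 (arXiv v5 p. 4: c(γ)); lane: width one] -/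
theorem surfContacts_one_zagWalk {s : ℤ} (hs : s = 1 ∨ s = -1) (j : ℕ) : surfContacts 1 (zagWalk s j) = j := by
  rw [zagWalk, surfContacts_one_zigInner hs]; omega

/-- **The full run `epsWalk s L` has `L + 1` surface contacts.** [cite: BeatonBousquetMelouDeGierDuminilCopinGuttmann2014, §2 (arXiv v5 p. 4: c(γ)); lane: width one] -/
theorem surfContacts_one_epsWalk {s : ℤ} (hs : s = 1 ∨ s = -1) (L : ℕ) : surfContacts 1 (epsWalk s L) = L + 1 := by
  rw [epsWalk, surfContacts_one_zigInner hs]; omega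

/-- **`A_{1,L}(x_c; y) = 2 x_c Σ_{j=1}^{L} (x_c² y)^j`**: two `α`-arcs of each odd length `2j+1`, each with `j` contacts.
[cite: BeatonBousquetMelouDeGierDuminilCopinGuttmann2014, §2 eq. (10) (arXiv v5 p. 6: A_{T,L}(x;y)); BeatonGuttmannJensen2012Adsorption, §2 (arXiv:1110.6695 p. 4: "A_0(x, y) = 2x³y/(1 − x²y)", denominator printed "1 − x²" sic); lane: the finite-L polynomial] -/
theorem stripGFy_alpha_one_eq (L : ℕ) (y : ℝ) :
    stripGFy 1 L IsAlphaDart y = 2 * hexCriticalFugacity * ∑ j ∈ Icc 1 L, (hexCriticalFugacity ^ 2 * y) ^ j := by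
  have hterm : ∀ j : ℕ, hexCriticalFugacity ^ (2 * j + 1) * y ^ j = hexCriticalFugacity * (hexCriticalFugacity ^ 2 * y) ^ j := by
    intro j; rw [mul_pow, ← pow_mul, pow_succ]; ring
  rw [stripGFy, filter_isAlphaDart_one_eq_image, sum_image (zagWalk_injOn L), sum_product,
    sum_pair (by norm_num : (1 : ℤ) ≠ -1)]
  simp only [mwLen_zagWalk, surfContacts_one_zagWalk (Or.inl rfl), surfContacts_one_zagWalk (Or.inr rfl), hterm, ← mul_sum]
  ring

/-- **`E_{1,L}(x_c; y) = 2 (x_c² y)^{L+1}`**: the two full runs, `2L + 2` vertices and `L + 1` contacts each.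
[cite: BeatonBousquetMelouDeGierDuminilCopinGuttmann2014, §2 eq. (10) (arXiv v5 p. 6: E_{T,L}(x;y)); lane: width one] -/
theorem stripGFy_eps_one_eq (L : ℕ) (y : ℝ) :
    stripGFy 1 L (IsEpsDart L) y = 2 * (hexCriticalFugacity ^ 2 * y) ^ (L + 1) := by
  rw [stripGFy, filter_isEpsDart_one_eq_image, sum_image, sum_pair (by norm_num : (1 : ℤ) ≠ -1), mwLen_epsWalk,
    mwLen_epsWalk, surfContacts_one_epsWalk (Or.inl rfl), surfContacts_one_epsWalk (Or.inr rfl)]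
  · ring
  · intro s hs s' hs' h
    have h2 : (epsWalk s L)[2]'(by rw [length_epsWalk]; omega) = (epsWalk s' L)[2]'(by rw [length_epsWalk]; omega) := by
      simp only [h]
    rw [epsWalk_getElem_two, epsWalk_getElem_two] at h2
    have := congrArg pos1 h2
    rwa [pos1_vtx, pos1_vtx] at this

/-! ### The profile at the threshold `y_1 = 2 + √2` -/

/-- ★ **`E_{1,L}(x_c; y_1) = 2` for every `L`**: at the width-one threshold the side-exit class is CONSTANT in the strip length (it
neither vanishes, as it does below `y_1`, nor diverges). [cite: BeatonBousquetMelouDeGierDuminilCopinGuttmann2014, §4.3 proof of Proposition 9 (arXiv v5 p. 14: E_{T,L}(x_c; y) → 0 for y < y_T); lane: the boundary case y = y_1, width one] -/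
theorem stripGFy_eps_one_stripYT_one (L : ℕ) : stripGFy 1 L (IsEpsDart L) (stripYT 1) = 2 := by
  rw [stripGFy_eps_one_eq, stripYT_one, hexCriticalFugacity_sq, one_pow, mul_one]

/-- ★ **`A_{1,L}(x_c; y_1) = 2 x_c · L`**: at the width-one threshold the arch class grows EXACTLY linearly in the strip length.
[cite: BeatonBousquetMelouDeGierDuminilCopinGuttmann2014, §3.2 Corollary 8 (arXiv v5 p. 12: A_T(x_c;·) has radius y_T); lane: explicit width-one instance at the radius] -/
theorem stripGFy_alpha_one_stripYT_one (L : ℕ) : stripGFy 1 L IsAlphaDart (stripYT 1) = 2 * hexCriticalFugacity * (L : ℝ) := by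
  rw [stripGFy_alpha_one_eq, stripYT_one, hexCriticalFugacity_sq]
  simp

/-- `A_{1,L}(x_c; y_1) → +∞`. [cite: BeatonBousquetMelouDeGierDuminilCopinGuttmann2014, §3.2 Corollary 8 (arXiv v5 p. 12); lane] -/
theorem tendsto_stripGFy_alpha_one_stripYT_one_atTop :
    Tendsto (fun L : ℕ => stripGFy 1 L IsAlphaDart (stripYT 1)) atTop atTop := by
  simp_rw [stripGFy_alpha_one_stripYT_one]
  exact tendsto_natCast_atTop_atTop.const_mul_atTop (by have := hexCriticalFugacity_pos_lt_one.1; positivity)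

/-- The identity (16) at `(T, y) = (1, y_1)` in closed form: `cos(3π/8)·(2x_c L) + cos(π/4)·2 + β(y_1)·2(L+1) = 1` for every `L`.
[cite: BeatonBousquetMelouDeGierDuminilCopinGuttmann2014, §4.1 eq. (16) (arXiv v5 p. 13); lane: width-one check at y_1] -/
theorem identityY_one_stripYT_one (L : ℕ) :
    Real.cos (3 * Real.pi / 8) * (2 * hexCriticalFugacity * (L : ℝ)) + Real.cos (Real.pi / 4) * 2 +
      betaY (stripYT 1) * (2 * ((L : ℝ) + 1)) = 1 := by
  have hq : hexCriticalFugacity ^ 2 * stripYT 1 = 1 := by rw [stripYT_one, hexCriticalFugacity_sq]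
  have hB : stripGFy 1 L (IsBetaDart 1) (stripYT 1) = 2 * ((L : ℝ) + 1) := by
    rw [stripGFy_beta_one_eq, hq]; simp
  have hpos : 0 < stripYT 1 := by rw [stripYT_one]; positivity
  have h := stripIdentityY_holds 1 L (stripYT 1) le_rfl hpos
  rwa [stripGFy_alpha_one_stripYT_one, stripGFy_eps_one_stripYT_one, hB] at h

end Literature.Probability.RandomPlanarGeometry.SAW.HV
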